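import Mathlib
import Summits.NavierStokesRegularity.OSWSelfSimilar.TypeIIInnerLimitEveryLimit
import Summits.NavierStokesRegularity.OSWSelfSimilar.TypeIIInnerLimitMasterDatum
import HarnessLib
/-!
# (I-4) for EVERY inner limit, at ANY viscosity, on DATUM-LEVEL hypotheses (zone Z1 TEMPLATE §T1.4-I (I-4), (K60) «the
# every-limit form at general ν»; kernel, unconditional)

HONEST FRAMING (cell ns-blowup GROUP B «PROFILE SEARCH», zone Z1; D-0035/D-0074): part XXXIX of the Z1 dictionary. Part
XXVIII (`innerLimit_alternative_of_every_zoom_limit`) is the EVERY-LIMIT form of the (α)/(β) alternative at `ν = 1` on the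
analytic-core hypotheses (classical, axisymmetric at all times, energy and sup bounds on closed sub-slabs): whatever
slice-wise locally uniform limit `W'` an instrument's max-centred gauge N-a zoom converges to, `W'` is a translate of a
KNSS blow-up limit `V` which is EITHER a constant unit field (`c₁ = 0`) OR an (AX-L) counterexample with the (I-5)
signature. This file transports it to ANY viscosity `ν > 0` and to the DATUM-LEVEL hypotheses of parts XXXV/XXXVI
(`IsMaximalSmoothSolution ν 0 u p T⋆`, Leray–Hopf, `HasRapidSpatialDecay (u 0)`, `IsAxisymmetric (u 0)`, `|Γ(0,·)| ≤ Mₛ`),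
for ANY ν-covariant gauge data `tₖ ∈ [t₁, T⋆)` (`t₁ > 0`), `λₖ > 0 → 0`, meridional near-max points `rₖe₀ + zₖe₂`,
`(λₖ/ν)‖u‖ ≤ 1` on `[0, tₖ]`, `(λₖ/ν)‖u(tₖ, rₖe₀ + zₖe₂)‖ → 1`, and ANY limit `W'` of the zoom
`y ↦ (λₖ/ν)u(tₖ + (λₖ²/ν)s, rₖe₀ + zₖe₂ + λₖy)`: via the unit-viscosity dilation `v = ν⁻¹u(ν⁻¹·)` frozen to `0` off the slab
(the device of part XXXV) and `zoom_timeRescale`.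

* `eventually_zoomTime_mem_Ico_of_le` — zoom times `tₖ + λₖ²s` (`s ≤ 0`) are eventually in `[0, T')` when `tₖ ≥ t₁ > 0`;
* `innerLimit_alternative_of_every_zoom_limit_datum` — the theorem.

**Nothing here asserts that a singular solution exists or that (AX-L) holds or fails.** «violates: n/a — dictionary;
(K60) item 'every-limit form at general ν' discharged (datum level)»; bears_on LADDER-NS N5/Z1 → N1 linear core / N0⁻.
Author: ns-blowup-profile-eng-1 g9, 2026-08-27.
-/

open Real Filter Topology Set MeasureTheory Function Bornology Metric
open scoped ENNReal NNReal
open Literature.Analysis.FluidPDE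
open Summit.NavierStokesRegularity.NavierStokesRegularity.Theorems.CertifiedBlowupAxisymBlowup.CompactAmplification

namespace Summit.NavierStokesRegularity.OSWSelfSimilar
namespace TypeIIModulationDictionary

section EveryLimitDatum

/-- Zoom times are eventually inside the slab (lower bound `t₁ > 0` form): if `t₁ ≤ tₖ < T'`, `λₖ → 0` and `s ≤ 0`, then
`tₖ + λₖ²s ∈ [0, T')` for all large `k`. [new here — elementary] -/
theorem eventually_zoomTime_mem_Ico_of_le {T' t₁ : ℝ} {tn lamn : ℕ → ℝ} (ht₁ : 0 < t₁)
    (htn : ∀ k, t₁ ≤ tn k ∧ tn k < T') (hlam0 : Tendsto lamn atTop (𝓝 0)) {s : ℝ} (hs : s ≤ 0) :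
    ∀ᶠ k in atTop, tn k + lamn k ^ 2 * s ∈ Ico 0 T' := by
  have h1 : Tendsto (fun k => lamn k ^ 2 * s) atTop (𝓝 0) := by
    simpa using (hlam0.pow 2).mul_const s
  have h2 : ∀ᶠ k in atTop, -t₁ < lamn k ^ 2 * s := h1.eventually (lt_mem_nhds (by linarith))
  filter_upwards [h2] with k hk
  have h3 : lamn k ^ 2 * s ≤ 0 := mul_nonpos_of_nonneg_of_nonpos (sq_nonneg _) hs
  exact ⟨by linarith [(htn k).1], by linarith [(htn k).2]⟩

variable {T ν Mₛ : ℝ} {u : ℝ → EuclideanSpace ℝ (Fin 3) → EuclideanSpace ℝ (Fin 3)}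
  {p : ℝ → EuclideanSpace ℝ (Fin 3) → ℝ}

/-- **TEMPLATE (I-4) FOR EVERY INNER LIMIT, ANY VISCOSITY, DATUM-LEVEL HYPOTHESES (unconditional).** Let `(u, p)` be a
maximal smooth unforced solution at viscosity `ν > 0` with lifespan `T⋆ > 0`, Leray–Hopf from its rapidly decaying
axisymmetric datum, `|Γ(0, ·)| ≤ Mₛ`; let `tₖ ∈ [t₁, T⋆)` (`t₁ > 0`), `λₖ > 0 → 0`, `rₖ ≥ 0`, `zₖ` be ANY ν-covariant gauge
N-a data (`(λₖ/ν)‖u‖ ≤ 1` on `[0, tₖ]`, `(λₖ/ν)‖u(tₖ, rₖe₀ + zₖe₂)‖ → 1`) and `W'` ANY slice-wise locally uniform limit of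
the max-centred zoom `y ↦ (λₖ/ν)u(tₖ + (λₖ²/ν)s, rₖe₀ + zₖe₂ + λₖy)`. Then there are `d₀ ≥ 0` and a KNSS blow-up limit `V`
(unit viscosity, with the Oseen identity) with `W'(s, y) = V(s, y + d₀e₀)` for `s < 0`, and EITHER (α) `V ≡ c ≡ W'` for ONE
vector `c`, `‖c‖ = 1`, `c₁ = 0`, OR (β) `AxisymmetricLiouvilleBoundedSwirl` FAILS, witnessed by `V` (axisymmetric slices,
`|Γ_V| ≤ Mₛ/ν`, a non-constant slice) with swirl, `r‖V_pol‖` and `r‖V_pol − ce_z‖` unbounded, `Γ_V ∉ L^∞_sL^q`, `Γ_V`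
non-decaying. Part XXVIII on the frozen unit-viscosity dilation. [new here — dictionary; unconditional, any ν > 0] -/
theorem innerLimit_alternative_of_every_zoom_limit_datum (hν : 0 < ν) (hT : 0 < T)
    (hmax : IsMaximalSmoothSolution ν 0 u p T) (hLH : IsLerayHopfOn T ν 0 (u 0) u)
    (hdec : HasRapidSpatialDecay (u 0)) (haxi : IsAxisymmetric (u 0)) (hMₛ : ∀ x, |swirl (u 0) x| ≤ Mₛ)
    {tn lamn rn zn : ℕ → ℝ} {t₁ : ℝ} (ht₁ : 0 < t₁) (htn : ∀ k, t₁ ≤ tn k ∧ tn k < T)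
    (hlam : ∀ k, 0 < lamn k) (hlam0 : Tendsto lamn atTop (𝓝 0)) (hrn : ∀ k, 0 ≤ rn k)
    (hgauge : ∀ k, ∀ t ∈ Icc 0 (tn k), ∀ x, lamn k / ν * ‖u t x‖ ≤ 1)
    (hnear : Tendsto (fun k => lamn k / ν *
      ‖u (tn k) (EuclideanSpace.single 0 (rn k) + EuclideanSpace.single 2 (zn k))‖) atTop (𝓝 1))
    {W' : ℝ → EuclideanSpace ℝ (Fin 3) → EuclideanSpace ℝ (Fin 3)}
    (hconvW' : ∀ s < 0, TendstoLocallyUniformly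
      (fun k => ((lamn k / ν) • stPull (lamn k ^ 2 / ν) (lamn k) (tn k)
        (EuclideanSpace.single 0 (rn k) + EuclideanSpace.single 2 (zn k)) u) s) (W' s) atTop) :
    ∃ (d₀ : ℝ) (V : ℝ → EuclideanSpace ℝ (Fin 3) → EuclideanSpace ℝ (Fin 3)), 0 ≤ d₀ ∧ IsKNSSBlowupLimit V ∧
      (∀ s t : ℝ, s < t → t < 0 → ∀ x,
        V t x = Literature.Analysis.UnboundedOperators.heatExtension (V s) (t - s) x - oseenDuhamel 1 s V V t x) ∧
      (∀ s < 0, ∀ y : EuclideanSpace ℝ (Fin 3), W' s y = V s (y + d₀ • EuclideanSpace.single 0 (1 : ℝ))) ∧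
      ((∃ c : EuclideanSpace ℝ (Fin 3), ‖c‖ = 1 ∧ c 1 = 0 ∧ (∀ s < 0, ∀ y : EuclideanSpace ℝ (Fin 3), V s y = c) ∧
          ∀ s < 0, ∀ y : EuclideanSpace ℝ (Fin 3), W' s y = c) ∨
        (¬ Summit.NavierStokesRegularity.NavierStokesRegularity.AxisymmetricLiouvilleBoundedSwirl ∧
          (∀ s < 0, IsAxisymmetric (V s)) ∧ (∀ s < 0, ∀ y : EuclideanSpace ℝ (Fin 3), |swirl (V s) y| ≤ Mₛ / ν) ∧
          (∃ s < 0, ∃ x : EuclideanSpace ℝ (Fin 3), V s x ≠ V s 0) ∧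
          (∃ s < 0, ∃ x : EuclideanSpace ℝ (Fin 3), swirl (V s) x ≠ 0) ∧
          (∀ C : ℝ, ∃ s < 0, ∃ x : EuclideanSpace ℝ (Fin 3), C < cylRadius x * ‖poloidalPart (V s) x‖) ∧
          (∀ c C : ℝ, ∃ s < 0, ∃ x : EuclideanSpace ℝ (Fin 3), C < cylRadius x * ‖poloidalPart (V s) x - c • eZ‖) ∧
          (∀ q : ℝ≥0∞, 1 ≤ q → q < ⊤ → ∀ K : ℝ≥0, ∃ s < 0, (K : ℝ≥0∞) < eLpNorm (swirl (V s)) q volume) ∧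
          ∃ ε : ℝ, 0 < ε ∧ ∀ R : ℝ, ∃ s < 0, ∃ x : EuclideanSpace ℝ (Fin 3),
            R ≤ cylRadius x ∧ ε < |swirl (V s) x|)) := by
  -- ### Step 1: unit viscosity
  set v : ℝ → EuclideanSpace ℝ (Fin 3) → EuclideanSpace ℝ (Fin 3) := timeRescale ν⁻¹ ν⁻¹ u with hv
  have hνT : 0 < ν * T := mul_pos hν hT
  have hmax' : IsMaximalSmoothSolution 1 0 v (timeRescale ν⁻¹ (ν⁻¹ ^ 2) p) (ν * T) := hmax.toUnitViscosity hν
  have hv0 : v 0 = ν⁻¹ • u 0 := by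
    funext x
    simp [hv, timeRescale_apply]
  have hLH' : IsLerayHopfOn (ν * T) 1 0 (v 0) v := by
    have h := hLH.viscosityRescale (inv_pos.2 hν)
    rw [inv_mul_cancel₀ hν.ne', timeRescale_zero_force, div_inv_eq_mul, mul_comm T ν] at h
    rwa [hv0]
  have hdec' : HasRapidSpatialDecay (v 0) := by
    rw [hv0]
    exact SereginSverak2002_pressureOneSidedBound.hasRapidSpatialDecay_const_smul
      (hmax.1.contDiff_velocity ⟨le_rfl, hT⟩) hdec ν⁻¹
  have haxi' : IsAxisymmetric (v 0) := by
    rw [hv0]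
    exact haxi.const_smul ν⁻¹
  have hMₛ' : ∀ x, |swirl (v 0) x| ≤ Mₛ / ν := fun x => by
    have h := swirl_timeRescale_zero (u := u) hMₛ ν⁻¹ ν⁻¹ x
    rwa [abs_of_pos (inv_pos.2 hν), inv_mul_eq_div] at h
  -- ### Step 2: standing hypotheses for `v` on the slab, from the datum
  have hbddv : ∀ S < ν * T, ∃ N : ℝ, 0 < N ∧ ∀ t ∈ Icc 0 S, ∀ x, ‖v t x‖ ≤ N := fun S hS => by
    obtain ⟨M, hM⟩ := bounded_before_of_lerayHopf_classical one_pos hmax'.1 hLH' hdec' haxi' S hS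
    exact ⟨max M 1, lt_max_of_lt_right one_pos, fun t ht x => (hM t ht x).trans (le_max_left _ _)⟩
  have haxiv : ∀ t ∈ Ico 0 (ν * T), IsAxisymmetric (v t) :=
    isAxisymmetric_slice_of_lerayHopf_classical one_pos hmax'.1 hLH' hdec' haxi'
  have hEv := energyBound_of_lerayHopf hLH'
  -- ### Step 3: freeze `v` off the slab
  set w : ℝ → EuclideanSpace ℝ (Fin 3) → EuclideanSpace ℝ (Fin 3) :=
    fun t => if 0 ≤ t ∧ t < ν * T then v t else 0 with hw
  have hw_eq : ∀ t ∈ Ico 0 (ν * T), w t = v t := fun t ht => by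
    simp only [hw, if_pos (show 0 ≤ t ∧ t < ν * T from ⟨ht.1, ht.2⟩)]
  have h0I : (0 : ℝ) ∈ Ico 0 (ν * T) := ⟨le_rfl, hνT⟩
  have hclw : IsClassicalNSSolutionOn (Ico 0 (ν * T)) 1 0 w (timeRescale ν⁻¹ (ν⁻¹ ^ 2) p) :=
    hmax'.1.congr_velocity hw_eq
  have haxiw : ∀ t, IsAxisymmetric (w t) := fun t => by
    by_cases ht : 0 ≤ t ∧ t < ν * T
    · rw [hw_eq t ht]
      exact haxiv t ht
    · have h0 : w t = 0 := by simp only [hw, if_neg ht]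
      rw [h0]
      exact isAxisymmetric_zero
  have hEw : ∀ S < ν * T, ∃ C : ℝ≥0∞, C < ⊤ ∧ ∀ t ∈ Icc 0 S, ∫⁻ x, ‖w t x‖ₑ ^ 2 ≤ C := fun S hS => by
    obtain ⟨C, hC, hb⟩ := hEv S hS
    exact ⟨C, hC, fun t ht => by rw [hw_eq t ⟨ht.1, lt_of_le_of_lt ht.2 hS⟩]; exact hb t ht⟩
  have hbddw : ∀ S < ν * T, ∃ N : ℝ, 0 < N ∧ ∀ t ∈ Icc 0 S, ∀ x, ‖w t x‖ ≤ N := fun S hS => by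
    obtain ⟨N, hN, hb⟩ := hbddv S hS
    exact ⟨N, hN, fun t ht x => by rw [hw_eq t ⟨ht.1, lt_of_le_of_lt ht.2 hS⟩]; exact hb t ht x⟩
  have hMₛw : ∀ x, |swirl (w 0) x| ≤ Mₛ / ν := fun x => by
    rw [hw_eq 0 h0I]
    exact hMₛ' x
  -- ### Step 4: the gauge data of `w`: times `ν tₖ`, the same scales and near-max points
  have hνt₁ : 0 < ν * t₁ := mul_pos hν ht₁
  have htn' : ∀ k, ν * t₁ ≤ ν * tn k ∧ ν * tn k < ν * T := fun k =>
    ⟨mul_le_mul_of_nonneg_left (htn k).1 hν.le, mul_lt_mul_of_pos_left (htn k).2 hν⟩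
  have htnI : ∀ k, ν * tn k ∈ Ico 0 (ν * T) := fun k => ⟨hνt₁.le.trans (htn' k).1, (htn' k).2⟩
  have hgaugev : ∀ k, ∀ t ∈ Icc 0 (ν * tn k), ∀ x, lamn k * ‖v t x‖ ≤ 1 := fun k t ht x => by
    rw [hv, timeRescale_apply, norm_smul, Real.norm_eq_abs, abs_of_pos (inv_pos.2 hν)]
    have hνt : ν⁻¹ * t ∈ Icc 0 (tn k) :=
      ⟨mul_nonneg (inv_pos.2 hν).le ht.1, by rw [inv_mul_le_iff₀ hν]; exact ht.2⟩
    have h := hgauge k (ν⁻¹ * t) hνt x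
    calc lamn k * (ν⁻¹ * ‖u (ν⁻¹ * t) x‖) = lamn k / ν * ‖u (ν⁻¹ * t) x‖ := by ring
      _ ≤ 1 := h
  have hgaugew : ∀ k, ∀ t ∈ Icc 0 (ν * tn k), ∀ x, lamn k * ‖w t x‖ ≤ 1 := fun k t ht x => by
    rw [hw_eq t ⟨ht.1, lt_of_le_of_lt ht.2 (htn' k).2⟩]
    exact hgaugev k t ht x
  have hnearw : Tendsto (fun k => lamn k *
      ‖w (ν * tn k) (EuclideanSpace.single 0 (rn k) + EuclideanSpace.single 2 (zn k))‖) atTop (𝓝 1) := by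
    refine hnear.congr fun k => ?_
    rw [hw_eq _ (htnI k), hv, timeRescale_apply, ← mul_assoc, inv_mul_cancel₀ hν.ne', one_mul, norm_smul,
      Real.norm_eq_abs, abs_of_pos (inv_pos.2 hν)]
    ring
  -- ### Step 5: the given zoom of `u` IS the zoom of `v` at times `ν tₖ`, and eventually that of `w`
  have hzt : ∀ s : ℝ, s ≤ 0 → ∀ᶠ k in atTop, ν * tn k + lamn k ^ 2 * s ∈ Ico 0 (ν * T) := fun s hs =>
    eventually_zoomTime_mem_Ico_of_le hνt₁ htn' hlam0 hs
  have hconvw : ∀ s < 0, TendstoLocallyUniformly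
      (fun k => (lamn k • stPull (lamn k ^ 2) (lamn k) (ν * tn k)
        (EuclideanSpace.single 0 (rn k) + EuclideanSpace.single 2 (zn k)) w) s) (W' s) atTop := by
    intro s hs
    have hconvv : TendstoLocallyUniformly
        (fun k => (lamn k • stPull (lamn k ^ 2) (lamn k) (ν * tn k)
          (EuclideanSpace.single 0 (rn k) + EuclideanSpace.single 2 (zn k)) v) s) (W' s) atTop := by
      refine (hconvW' s hs).congr fun k => ?_
      rw [hv, zoom_timeRescale, ← mul_assoc, inv_mul_cancel₀ hν.ne', one_mul]
      intro x
      rfl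
    exact hconvv.congr_inseparable ((hzt s hs.le).mono fun k hk y => Inseparable.of_eq (by
      simp only [Pi.smul_apply, stPull_apply]
      rw [hw_eq _ hk]))
  -- ### Step 6: part XXVIII on `w`
  exact innerLimit_alternative_of_every_zoom_limit hνT hclw haxiw hEw hbddw hMₛw hνt₁ htn' hlam hlam0 hrn hgaugew
    hnearw hconvw

end EveryLimitDatum

end TypeIIModulationDictionary
end Summit.NavierStokesRegularity.OSWSelfSimilar
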